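import Summits.AtomisticToContinuum.HydrodynamicLimit.Theorems.BoxDissipativeWeakStrongRelativeEnergyStabilityDefs
import HarnessLib

/-!
# Crux `RelativeEnergyStability` (stmt-AtomisticToContinuum-17653), line `registered`:
stub `stub_forcedGronwall` (S-G) — Grönwall with pointwise `o(1)` forcing

Pure real analysis. For measurable `f_N`, uniformly bounded on `[0,τ]`, with
`f_N(t) ≤ f_N(0) + C∫₀ᵗ f_N + err_N(t)` on `[0,τ]`, `err_N(t) → 0` for each fixed `t` (nothing else is
known about `err`) and `f_N(0) → 0`, we show `limsup_N f_N(t) ≤ 0` at every `t ∈ [0,τ]`, in the form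
`∀ ε > 0, ∀ᶠ N, f_N(t) ≤ ε`.

Proof. First replace `f_N` by its indicator on `[0,τ]` (all hypotheses only see `[0,τ]`), so that `f_N` is
globally bounded and all interval integrals make sense (`stub_forcedGronwall` from `fg_bounded_case`).
With the continuous primitive `F_N(t) := ∫₀ᵗ f_N` and the defect `e_N(s) := f_N(s) − f_N(0) − C F_N(s)`
(measurable, `≤ err_N(s)` on `[0,τ]`, bounded by `2B + CB|s|`):
* `F_N(x) = x f_N(0) + C∫₀ˣ F_N + ∫₀ˣ e_N ≤ τ|f_N(0)| + ∫₀^τ e_N⁺ + C∫₀ˣ F_N` (`fg_primitive_le`);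
* `β_N := ∫₀^τ e_N⁺ → 0` by dominated convergence, since `0 ≤ e_N⁺(s) ≤ err_N(s)⁺ → 0` pointwise
  (`fg_defect_tendsto`);
* Grönwall for the continuous `F_N` with the constant forcing `α_N := τ|f_N(0)| + β_N`: applying Mathlib's
  `le_gronwallBound_of_liminf_deriv_right_le` to `G(t) := ∫₀ᵗ F_N` (`G' = F_N ≤ α_N + C G`) gives
  `F_N(x) ≤ α_N e^{Cx}` (`fg_gronwall_integral`);
* finally `f_N(t) ≤ f_N(0) + C α_N e^{Ct} + err_N(t)`, and all three terms tend to `0`.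
References: the standard integral Grönwall lemma; consumer: the heart stub `stub_clampedRelEnergyGronwall`
(BrezinaFeireisl2018 §3.2, Grönwall step run in expectation with pointwise-in-time `o(1)` errors).
-/

noncomputable section

namespace Summit.AtomisticToContinuum.HydrodynamicLimit.Theorems.RES

open MeasureTheory Filter Set
open scoped Topology Interval

/-- A globally bounded measurable real function is interval integrable on every interval. -/
theorem fg_intervalIntegrable {g : ℝ → ℝ} {B : ℝ} (hg : Measurable g) (hB : ∀ t, |g t| ≤ B)
    (a b : ℝ) : IntervalIntegrable g volume a b :=
  (intervalIntegrable_const (c := B)).mono_fun' hg.aestronglyMeasurable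
    (Eventually.of_forall fun t => by simpa only [Real.norm_eq_abs] using hB t)

/-- Integral Grönwall lemma for a continuous function with constant forcing: if
`F x ≤ α + C ∫₀ˣ F` on `[0,τ]` (`C ≥ 0`), then `F x ≤ α e^{Cx}` on `[0,τ]`. Proof: Mathlib's differential
Grönwall bound for `G(t) = ∫₀ᵗ F`, `G' = F ≤ C G + α`, `G 0 = 0`. -/
theorem fg_gronwall_integral {F : ℝ → ℝ} (hF : Continuous F) {α C τ : ℝ} (hC : 0 ≤ C)
    (h : ∀ x ∈ Icc 0 τ, F x ≤ α + C * ∫ s in (0:ℝ)..x, F s) :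
    ∀ x ∈ Icc 0 τ, F x ≤ α * Real.exp (C * x) := by
  have hFi : ∀ a b, IntervalIntegrable F volume a b := fun a b => hF.intervalIntegrable a b
  have hG : ∀ x ∈ Icc 0 τ, (∫ s in (0:ℝ)..x, F s) ≤ gronwallBound 0 C α (x - 0) :=
    le_gronwallBound_of_liminf_deriv_right_le (f := fun t => ∫ s in (0:ℝ)..t, F s) (f' := F)
      (intervalIntegral.continuous_primitive hFi 0).continuousOn
      (fun t _ r hr =>
        (hF.integral_hasStrictDerivAt 0 t).hasDerivAt.hasDerivWithinAt.liminf_right_slope_le hr)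
      (by simp)
      (fun t ht => by linarith [h t (Ico_subset_Icc_self ht)])
  intro x hx
  have hGx := hG x hx
  rw [sub_zero] at hGx
  calc F x ≤ α + C * ∫ s in (0:ℝ)..x, F s := h x hx
    _ ≤ α + C * gronwallBound 0 C α x := by linarith [mul_le_mul_of_nonneg_left hGx hC]
    _ = α * Real.exp (C * x) := by
      rcases eq_or_ne C 0 with rfl | hC0
      · simp
      · simp only [gronwallBound_of_K_ne_0 hC0]
        field_simp
        ring

/-- Splitting the primitive. For a globally bounded measurable `g`, with `F x = ∫₀ˣ g` and the defect
`e s = g s − g 0 − C F s`: `F x = x g 0 + C∫₀ˣ F + ∫₀ˣ e ≤ τ|g 0| + ∫₀^τ e⁺ + C ∫₀ˣ F` for `x ∈ [0,τ]`. -/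
theorem fg_primitive_le {g : ℝ → ℝ} {B C τ x : ℝ} (hg : Measurable g) (hB : ∀ t, |g t| ≤ B)
    (hx : x ∈ Icc 0 τ) :
    (∫ s in (0:ℝ)..x, g s) ≤ τ * |g 0|
      + (∫ s in (0:ℝ)..τ, max (g s - g 0 - C * ∫ u in (0:ℝ)..s, g u) 0)
      + C * ∫ s in (0:ℝ)..x, ∫ u in (0:ℝ)..s, g u := by
  have hgi : ∀ a b, IntervalIntegrable g volume a b := fg_intervalIntegrable hg hB
  have hFc : Continuous fun s => ∫ u in (0:ℝ)..s, g u := intervalIntegral.continuous_primitive hgi 0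
  have hFi : ∀ a b, IntervalIntegrable (fun s => ∫ u in (0:ℝ)..s, g u) volume a b :=
    fun a b => hFc.intervalIntegrable a b
  have hli : ∀ a b, IntervalIntegrable (fun s => g 0 + C * ∫ u in (0:ℝ)..s, g u) volume a b :=
    fun a b => intervalIntegrable_const.add ((hFi a b).const_mul C)
  have hei : ∀ a b,
      IntervalIntegrable (fun s => g s - g 0 - C * ∫ u in (0:ℝ)..s, g u) volume a b :=
    fun a b => ((hgi a b).sub intervalIntegrable_const).sub ((hFi a b).const_mul C)
  have hepi : ∀ a b,
      IntervalIntegrable (fun s => max (g s - g 0 - C * ∫ u in (0:ℝ)..s, g u) 0) volume a b :=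
    fun a b => ⟨Integrable.pos_part (hei a b).1, Integrable.pos_part (hei a b).2⟩
  -- split `g = (g 0 + C F) + e` under the integral
  have hsplit : (∫ s in (0:ℝ)..x, g s) = (∫ s in (0:ℝ)..x, (g 0 + C * ∫ u in (0:ℝ)..s, g u))
      + ∫ s in (0:ℝ)..x, (g s - g 0 - C * ∫ u in (0:ℝ)..s, g u) := by
    rw [← intervalIntegral.integral_add (hli 0 x) (hei 0 x)]
    refine intervalIntegral.integral_congr fun s _ => ?_
    ring
  have hlin : (∫ s in (0:ℝ)..x, (g 0 + C * ∫ u in (0:ℝ)..s, g u))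
      = x * g 0 + C * ∫ s in (0:ℝ)..x, ∫ u in (0:ℝ)..s, g u := by
    rw [intervalIntegral.integral_add intervalIntegrable_const ((hFi 0 x).const_mul C),
      intervalIntegral.integral_const, intervalIntegral.integral_const_mul]
    simp
  have hdef : (∫ s in (0:ℝ)..x, (g s - g 0 - C * ∫ u in (0:ℝ)..s, g u))
      ≤ ∫ s in (0:ℝ)..τ, max (g s - g 0 - C * ∫ u in (0:ℝ)..s, g u) 0 :=
    calc (∫ s in (0:ℝ)..x, (g s - g 0 - C * ∫ u in (0:ℝ)..s, g u))
        ≤ ∫ s in (0:ℝ)..x, max (g s - g 0 - C * ∫ u in (0:ℝ)..s, g u) 0 :=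
          intervalIntegral.integral_mono_on hx.1 (hei 0 x) (hepi 0 x) fun s _ => le_max_left _ _
      _ ≤ ∫ s in (0:ℝ)..τ, max (g s - g 0 - C * ∫ u in (0:ℝ)..s, g u) 0 :=
          intervalIntegral.integral_mono_interval le_rfl hx.1 hx.2
            (Eventually.of_forall fun s => le_max_right _ _) (hepi 0 τ)
  have h0 : x * g 0 ≤ τ * |g 0| :=
    calc x * g 0 ≤ x * |g 0| := mul_le_mul_of_nonneg_left (le_abs_self _) hx.1
      _ ≤ τ * |g 0| := mul_le_mul_of_nonneg_right hx.2 (abs_nonneg _)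
  rw [hsplit, hlin]
  linarith

/-- Dominated convergence for the positive part of the defect: with `e_N(s) = f_N(s) − f_N(0) − C∫₀ˢ f_N`
(`≤ err_N(s)` on `[0,τ]`, measurable, `|e_N⁺(s)| ≤ 2B + CB|s|`), `∫₀^τ e_N⁺ → 0`. -/
theorem fg_defect_tendsto (f err : ℕ → ℝ → ℝ) (τ C B : ℝ) (hτ : 0 ≤ τ) (hC : 0 ≤ C)
    (hB : ∀ N t, |f N t| ≤ B) (hf : ∀ N, Measurable (f N))
    (hineq : ∀ N, ∀ t ∈ Icc 0 τ, f N t ≤ f N 0 + C * (∫ s in (0:ℝ)..t, f N s) + err N t)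
    (herr : ∀ t ∈ Icc 0 τ, Tendsto (fun N => err N t) atTop (𝓝 0)) :
    Tendsto (fun N => ∫ s in (0:ℝ)..τ, max (f N s - f N 0 - C * ∫ u in (0:ℝ)..s, f N u) 0)
      atTop (𝓝 0) := by
  have hB0 : 0 ≤ B := (abs_nonneg _).trans (hB 0 0)
  have hfi : ∀ N a b, IntervalIntegrable (f N) volume a b :=
    fun N => fg_intervalIntegrable (hf N) (hB N)
  have hFb : ∀ N s, |∫ u in (0:ℝ)..s, f N u| ≤ B * |s| := fun N s => by
    simpa [Real.norm_eq_abs] using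
      intervalIntegral.norm_integral_le_of_norm_le_const (a := (0:ℝ)) (b := s) (f := f N) (C := B)
        fun u _ => by simpa only [Real.norm_eq_abs] using hB N u
  -- measurability of the positive part of the defect
  have hmeas : ∀ N, Measurable fun s => max (f N s - f N 0 - C * ∫ u in (0:ℝ)..s, f N u) 0 :=
    fun N => (((hf N).sub measurable_const).sub
      (measurable_const.mul (intervalIntegral.continuous_primitive (hfi N) 0).measurable)).max
        measurable_const
  -- uniform bound
  have hbd : ∀ N s, |max (f N s - f N 0 - C * ∫ u in (0:ℝ)..s, f N u) 0| ≤ 2 * B + C * (B * |s|) := by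
    intro N s
    have h1 : f N s ≤ B := (le_abs_self _).trans (hB N s)
    have h2 : -f N 0 ≤ B := (neg_le_abs _).trans (hB N 0)
    have h3 : -(C * ∫ u in (0:ℝ)..s, f N u) ≤ C * (B * |s|) := by
      rw [← mul_neg]
      exact mul_le_mul_of_nonneg_left ((neg_le_abs _).trans (hFb N s)) hC
    have h4 : 0 ≤ C * (B * |s|) := by positivity
    rw [abs_of_nonneg (le_max_right _ _)]
    exact max_le (by linarith) (by linarith)
  -- pointwise convergence on `[0,τ]`: `0 ≤ e_N⁺(s) ≤ err_N(s)⁺ → 0`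
  have hlim : ∀ᵐ s ∂(volume : Measure ℝ), s ∈ Ι (0:ℝ) τ →
      Tendsto (fun N => max (f N s - f N 0 - C * ∫ u in (0:ℝ)..s, f N u) 0) atTop (𝓝 0) := by
    refine ae_of_all _ fun s hs => ?_
    rw [uIoc_of_le hτ] at hs
    have hs' : s ∈ Icc 0 τ := ⟨hs.1.le, hs.2⟩
    have hup : Tendsto (fun N => max (err N s) 0) atTop (𝓝 (max 0 0)) :=
      (herr s hs').max tendsto_const_nhds
    rw [max_self] at hup
    exact tendsto_of_tendsto_of_tendsto_of_le_of_le tendsto_const_nhds hup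
      (fun N => le_max_right _ _) (fun N => max_le_max (by linarith [hineq N s hs']) le_rfl)
  have key := intervalIntegral.tendsto_integral_filter_of_dominated_convergence
    (μ := volume) (a := (0:ℝ)) (b := τ) (l := atTop)
    (F := fun N s => max (f N s - f N 0 - C * ∫ u in (0:ℝ)..s, f N u) 0) (f := fun _ => (0:ℝ))
    (fun s => 2 * B + C * (B * |s|))
    (Eventually.of_forall fun N => (hmeas N).aestronglyMeasurable)
    (Eventually.of_forall fun N => ae_of_all _ fun s _ => by
      simpa only [Real.norm_eq_abs] using hbd N s)
    ((by fun_prop : Continuous fun s : ℝ => 2 * B + C * (B * |s|)).intervalIntegrable 0 τ)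
    hlim
  simpa only [intervalIntegral.integral_zero] using key

/-- The globally bounded case of `stub_forcedGronwall` (`|f N t| ≤ B` for ALL `t`). -/
theorem fg_bounded_case (f err : ℕ → ℝ → ℝ) (τ C B : ℝ) (hτ : 0 ≤ τ) (hC : 0 ≤ C)
    (hB : ∀ N t, |f N t| ≤ B) (hf : ∀ N, Measurable (f N))
    (hineq : ∀ N, ∀ t ∈ Icc 0 τ, f N t ≤ f N 0 + C * (∫ s in (0:ℝ)..t, f N s) + err N t)
    (herr : ∀ t ∈ Icc 0 τ, Tendsto (fun N => err N t) atTop (𝓝 0))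
    (hf0 : Tendsto (fun N => f N 0) atTop (𝓝 0)) :
    ∀ t ∈ Icc 0 τ, ∀ ε > (0:ℝ), ∀ᶠ N in atTop, f N t ≤ ε := by
  intro t₀ ht₀ ε hε
  -- the forcing `α_N := τ |f N 0| + ∫₀^τ e_N⁺ → 0`
  have hα : Tendsto (fun N => τ * |f N 0|
      + ∫ s in (0:ℝ)..τ, max (f N s - f N 0 - C * ∫ u in (0:ℝ)..s, f N u) 0) atTop (𝓝 0) := by
    have := (hf0.abs.const_mul τ).add (fg_defect_tendsto f err τ C B hτ hC hB hf hineq herr)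
    simpa only [abs_zero, mul_zero, zero_add] using this
  -- Grönwall for the continuous primitive `F_N`
  have hF : ∀ N, (∫ s in (0:ℝ)..t₀, f N s) ≤ (τ * |f N 0|
      + ∫ s in (0:ℝ)..τ, max (f N s - f N 0 - C * ∫ u in (0:ℝ)..s, f N u) 0) * Real.exp (C * t₀) :=
    fun N => fg_gronwall_integral (intervalIntegral.continuous_primitive
      (fg_intervalIntegrable (hf N) (hB N)) 0) hC (fun x hx => fg_primitive_le (hf N) (hB N) hx) t₀ ht₀
  have hmain : ∀ N, f N t₀ ≤ f N 0 + C * ((τ * |f N 0|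
      + ∫ s in (0:ℝ)..τ, max (f N s - f N 0 - C * ∫ u in (0:ℝ)..s, f N u) 0) * Real.exp (C * t₀))
      + err N t₀ := fun N => by
    have h1 := hineq N t₀ ht₀
    have h2 := mul_le_mul_of_nonneg_left (hF N) hC
    linarith
  have hlim : Tendsto (fun N => f N 0 + C * ((τ * |f N 0|
      + ∫ s in (0:ℝ)..τ, max (f N s - f N 0 - C * ∫ u in (0:ℝ)..s, f N u) 0) * Real.exp (C * t₀))
      + err N t₀) atTop (𝓝 0) := by
    have := (hf0.add ((hα.mul_const (Real.exp (C * t₀))).const_mul C)).add (herr t₀ ht₀)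
    simpa only [zero_mul, mul_zero, add_zero] using this
  exact (hlim.eventually_le_const hε).mono fun N hN => (hmain N).trans hN

/-- **S-G — Grönwall with pointwise `o(1)` forcing (real analysis; size S).** For uniformly bounded measurable
`f_N` on `[0,τ]` with `f_N(t) ≤ f_N(0) + C∫₀ᵗ f_N + err_N(t)`, `err_N(t) → 0` for each `t` (no measurability or
bound on `err` is assumed) and `f_N(0) → 0`: `limsup_N f_N(t) ≤ 0` at every `t ∈ [0,τ]`. Reduced to the globally
bounded case `fg_bounded_case` by replacing `f_N` with its indicator on `[0,τ]` (the hypotheses only involve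
values and integrals of `f_N` on `[0,τ]`). -/
theorem stub_forcedGronwall :
    ∀ (f err : ℕ → ℝ → ℝ) (τ C B : ℝ), 0 ≤ τ → 0 ≤ C →
      (∀ N, ∀ t ∈ Icc 0 τ, |f N t| ≤ B) → (∀ N, Measurable (f N)) →
      (∀ N, ∀ t ∈ Icc 0 τ, f N t ≤ f N 0 + C * (∫ s in (0:ℝ)..t, f N s) + err N t) →
      (∀ t ∈ Icc 0 τ, Tendsto (fun N => err N t) atTop (𝓝 0)) →
      Tendsto (fun N => f N 0) atTop (𝓝 0) →
      ∀ t ∈ Icc 0 τ, ∀ ε > (0:ℝ), ∀ᶠ N in atTop, f N t ≤ ε := by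
  intro f err τ C B hτ hC hB hf hineq herr hf0 t₀ ht₀ ε hε
  have h0 : (0:ℝ) ∈ Icc 0 τ := ⟨le_rfl, hτ⟩
  have hB0 : 0 ≤ B := (abs_nonneg _).trans (hB 0 0 h0)
  -- the indicator of `f N` on `[0,τ]`
  obtain ⟨g, hg⟩ : ∃ g : ℕ → ℝ → ℝ, ∀ N, g N = (Icc 0 τ).indicator (f N) := ⟨_, fun _ => rfl⟩
  have hg_eq : ∀ N, ∀ t ∈ Icc 0 τ, g N t = f N t := fun N t ht => by
    rw [hg]
    exact indicator_of_mem ht _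
  have hg_int : ∀ N, ∀ t ∈ Icc 0 τ, (∫ s in (0:ℝ)..t, g N s) = ∫ s in (0:ℝ)..t, f N s := by
    intro N t ht
    refine intervalIntegral.integral_congr fun s hs => hg_eq N s ?_
    rw [uIcc_of_le ht.1] at hs
    exact ⟨hs.1, hs.2.trans ht.2⟩
  have hgB : ∀ N t, |g N t| ≤ B := by
    intro N t
    by_cases ht : t ∈ Icc 0 τ
    · rw [hg_eq N t ht]
      exact hB N t ht
    · rw [hg, indicator_of_notMem ht, abs_zero]
      exact hB0
  have hgm : ∀ N, Measurable (g N) := fun N => by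
    rw [hg]
    exact (hf N).indicator measurableSet_Icc
  have hgineq : ∀ N, ∀ t ∈ Icc 0 τ, g N t ≤ g N 0 + C * (∫ s in (0:ℝ)..t, g N s) + err N t := by
    intro N t ht
    rw [hg_eq N t ht, hg_eq N 0 h0, hg_int N t ht]
    exact hineq N t ht
  have hg0 : Tendsto (fun N => g N 0) atTop (𝓝 0) := hf0.congr fun N => (hg_eq N 0 h0).symm
  have key := fg_bounded_case g err τ C B hτ hC hgB hgm hgineq herr hg0 t₀ ht₀ ε hε
  exact key.mono fun N hN => by
    rw [← hg_eq N t₀ ht₀]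
    exact hN

end Summit.AtomisticToContinuum.HydrodynamicLimit.Theorems.RES

end
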